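/-
Copyright (c) 2026. All rights reserved.
Released under Apache 2.0 license as described in the file LICENSE.
-/
import Literature.Geometry.Riemannian.IndexFluxLimit
import Mathlib.Geometry.Manifold.MFDeriv.NormedSpace
import Mathlib.Geometry.Manifold.MFDeriv.Atlas
import Mathlib.Geometry.Manifold.ContMDiff.Atlas
import Mathlib.Geometry.Manifold.ContMDiff.NormedSpace

/-!
# The index-flux cutoff transported to a manifold

[scope: pseudo-Riemannian/manifold]

For the Poincaré–Hopf proof of the Gauss–Bonnet theorem
(`Literature/Geometry/Riemannian/GaussBonnetLocal.lean`, `GaussBonnet.lean`) we transport the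
Euclidean cutoff `χ_r(x) = θ(‖T(x − c)‖²/r²)` of `IndexFluxLimit.lean` to a manifold through the
extended chart at a point `p`: `mcutoff I p T r y = χ_r(φ y)` on the chart domain (`c = φ p`) and
`1` outside. For `r` small (the closed ball of radius `2 r ‖T⁻¹‖` around `φ p` inside the chart
target) it is smooth (`contMDiff_mcutoff`), equal to `1` off the compact set
`mcutoffSupport I p T r = φ⁻¹(closedBall (φ p) (2 r ‖T⁻¹‖))` and to `0` near `p`, and its
differential on the chart domain is `Dχ̂_r(φ y) ∘ Dφ_y` (`mvfderiv_mcutoff_apply`). We also record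
the continuity of `x ↦ Dχ̂_r(x)(X x)` for fields continuous on a punctured ball
(`continuous_fderiv_cutoff_apply`).

## References

* J. Milnor, *Topology from the differentiable viewpoint* (1965), §6 (local index computations in
  a chart). [folklore]
-/

open Bundle Set Metric Filter Function
open Literature.Geometry.Riemannian.IndexFlux
open scoped ContDiff Manifold Topology RealInnerProductSpace

noncomputable section

namespace Literature.Geometry.Riemannian

/-! ### The cutoff transported to the manifold -/

section Cutoff

variable {E : Type*} [NormedAddCommGroup E] [InnerProductSpace ℝ E]
  {H : Type*} [TopologicalSpace H] {I : ModelWithCorners ℝ E H}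
  {N : Type*} [TopologicalSpace N] [ChartedSpace H N]

omit [TopologicalSpace H] in
/-- Where the cutoff differs from `1`, `‖T (x - c)‖ < 2 r`. [folklore] -/
theorem norm_lt_of_cutoff_ne_one {T : E →L[ℝ] E} {c : E} {r : ℝ} (hr : 0 < r) {x : E}
    (hx : cutoff T c r x ≠ 1) : ‖T (x - c)‖ < 2 * r := by
  by_contra h
  rw [not_lt] at h
  apply hx
  rw [cutoff_apply, profile_of_four_le]
  rw [le_div_iff₀ (by positivity)]
  nlinarith [norm_nonneg (T (x - c))]

omit [TopologicalSpace H] in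
/-- Where the cutoff differs from `1`, `‖x - c‖ ≤ 2 r ‖T⁻¹‖`. [folklore] -/
theorem mem_closedBall_of_cutoff_ne_one (T : E ≃L[ℝ] E) {c : E} {r : ℝ} (hr : 0 < r) {x : E}
    (hx : cutoff (T : E →L[ℝ] E) c r x ≠ 1) :
    x ∈ closedBall c (2 * r * ‖(T.symm : E →L[ℝ] E)‖) := by
  have h := norm_lt_of_cutoff_ne_one hr hx
  rw [mem_closedBall_iff_norm]
  calc ‖x - c‖ = ‖(T.symm : E →L[ℝ] E) (T (x - c))‖ := by simp
    _ ≤ ‖(T.symm : E →L[ℝ] E)‖ * ‖T (x - c)‖ := (T.symm : E →L[ℝ] E).le_opNorm _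
    _ ≤ ‖(T.symm : E →L[ℝ] E)‖ * (2 * r) := by gcongr; exact h.le
    _ = 2 * r * ‖(T.symm : E →L[ℝ] E)‖ := by ring

omit [TopologicalSpace H] in
/-- Where the derivative of the cutoff is nonzero, `‖x - c‖ ≤ 2 r ‖T⁻¹‖`. [folklore] -/
theorem mem_closedBall_of_fderiv_cutoff_ne_zero (T : E ≃L[ℝ] E) {c : E} {r : ℝ} (hr : 0 < r)
    {x : E} (hx : fderiv ℝ (cutoff (T : E →L[ℝ] E) c r) x ≠ 0) :
    x ∈ closedBall c (2 * r * ‖(T.symm : E →L[ℝ] E)‖) := by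
  have h : ‖T (x - c)‖ ≤ 2 * r := (norm_le_of_fderiv_cutoff_ne_zero hr hx).2
  rw [mem_closedBall_iff_norm]
  calc ‖x - c‖ = ‖(T.symm : E →L[ℝ] E) (T (x - c))‖ := by simp
    _ ≤ ‖(T.symm : E →L[ℝ] E)‖ * ‖T (x - c)‖ := (T.symm : E →L[ℝ] E).le_opNorm _
    _ ≤ ‖(T.symm : E →L[ℝ] E)‖ * (2 * r) := by gcongr
    _ = 2 * r * ‖(T.symm : E →L[ℝ] E)‖ := by ring

omit [TopologicalSpace H] in
/-- **Continuity of `x ↦ dχ_r(x)(X x)`** for a field `X` continuous on a punctured ball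
containing the annulus where `dχ_r ≠ 0`. [folklore] -/
theorem continuous_fderiv_cutoff_apply (T : E ≃L[ℝ] E) {c : E} {r δ : ℝ} (hr : 0 < r)
    (hδ : 2 * r * ‖(T.symm : E →L[ℝ] E)‖ < δ) {X : E → E}
    (hX : ContinuousOn X (ball c δ \ {c})) :
    Continuous fun x ↦ fderiv ℝ (cutoff (T : E →L[ℝ] E) c r) x (X x) := by
  rw [continuous_iff_continuousAt]
  intro x
  by_cases hq : ‖T (x - c)‖ ^ 2 / r ^ 2 < 1 ∨ 4 < ‖T (x - c)‖ ^ 2 / r ^ 2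
  · have hqc : Continuous fun y : E ↦ ‖T (y - c)‖ ^ 2 / r ^ 2 :=
      (((T : E →L[ℝ] E).continuous.comp (continuous_id.sub continuous_const)).norm.pow 2).div_const
        _
    have hev : ∀ᶠ y in 𝓝 x, ‖T (y - c)‖ ^ 2 / r ^ 2 < 1 ∨ 4 < ‖T (y - c)‖ ^ 2 / r ^ 2 := by
      rcases hq with hq | hq
      · exact (hqc.continuousAt.eventually (Iio_mem_nhds hq)).mono fun y hy ↦ Or.inl hy
      · exact (hqc.continuousAt.eventually (Ioi_mem_nhds hq)).mono fun y hy ↦ Or.inr hy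
    refine continuousAt_const.congr (f := fun _ ↦ (0 : ℝ)) ?_
    filter_upwards [hev] with y hy
    rw [fderiv_cutoff_eq_zero hy, _root_.zero_apply]
  · rw [not_or, not_lt, not_lt] at hq
    have hr1 : r ≤ ‖T (x - c)‖ := by
      have := hq.1
      rw [le_div_iff₀ (by positivity)] at this
      nlinarith [norm_nonneg (T (x - c))]
    have hr2 : ‖T (x - c)‖ ≤ 2 * r := by
      have := hq.2
      rw [div_le_iff₀ (by positivity)] at this
      nlinarith [norm_nonneg (T (x - c))]
    have hxc : ‖x - c‖ ≤ 2 * r * ‖(T.symm : E →L[ℝ] E)‖ := by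
      calc ‖x - c‖ = ‖(T.symm : E →L[ℝ] E) (T (x - c))‖ := by simp
        _ ≤ ‖(T.symm : E →L[ℝ] E)‖ * ‖T (x - c)‖ := (T.symm : E →L[ℝ] E).le_opNorm _
        _ ≤ ‖(T.symm : E →L[ℝ] E)‖ * (2 * r) := by gcongr
        _ = 2 * r * ‖(T.symm : E →L[ℝ] E)‖ := by ring
    have hxball : x ∈ ball c δ := mem_ball_iff_norm.2 (hxc.trans_lt hδ)
    have hxne : x ≠ c := by
      rintro rfl
      simp only [sub_self, map_zero, norm_zero] at hr1
      linarith
    have hU : ball c δ \ {c} ∈ 𝓝 x :=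
      (isOpen_ball.sdiff isClosed_singleton).mem_nhds ⟨hxball, hxne⟩
    exact ((continuous_fderiv_cutoff (T : E →L[ℝ] E) c r).continuousOn.clm_apply hX).continuousAt
      hU

open scoped Classical in
variable (I) in
/-- **The cutoff transported to the manifold**: `χ_r(y) = θ(‖T(φ y − φ p)‖² / r²)` for `y` in the
chart domain of `p` (`φ = extChartAt I p`), and `1` outside. For `r` small it is smooth, equal to
`1` off a compact subset of the chart domain and to `0` near `p` (below). [folklore] -/
def mcutoff (p : N) (T : E →L[ℝ] E) (r : ℝ) (y : N) : ℝ :=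
  if y ∈ (extChartAt I p).source then cutoff T (extChartAt I p p) r (extChartAt I p y) else 1

/-- On the chart domain, `mcutoff` is the Euclidean cutoff at `φ y`. [folklore] -/
theorem mcutoff_of_mem {p : N} {T : E →L[ℝ] E} {r : ℝ} {y : N}
    (hy : y ∈ (extChartAt I p).source) :
    mcutoff I p T r y = cutoff T (extChartAt I p p) r (extChartAt I p y) := by
  rw [mcutoff, if_pos hy]

/-- Off the chart domain, `mcutoff` is `1`. [folklore] -/
theorem mcutoff_of_not_mem {p : N} {T : E →L[ℝ] E} {r : ℝ} {y : N}
    (hy : y ∉ (extChartAt I p).source) : mcutoff I p T r y = 1 := by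
  rw [mcutoff, if_neg hy]

variable (I) in
/-- The compact set `φ⁻¹(closedBall (φ p) (2 r ‖T⁻¹‖))` off which the cutoff is `1`. [folklore] -/
def mcutoffSupport (p : N) (T : E ≃L[ℝ] E) (r : ℝ) : Set N :=
  (extChartAt I p).symm '' closedBall (extChartAt I p p) (2 * r * ‖(T.symm : E →L[ℝ] E)‖)

/-- `mcutoffSupport` lies in the chart domain (when the closed ball lies in the chart target).
[folklore] -/
theorem mcutoffSupport_subset_source (p : N) (T : E ≃L[ℝ] E) {r : ℝ}
    (hR : closedBall (extChartAt I p p) (2 * r * ‖(T.symm : E →L[ℝ] E)‖) ⊆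
      (extChartAt I p).target) :
    mcutoffSupport I p T r ⊆ (extChartAt I p).source := by
  rintro _ ⟨x, hx, rfl⟩
  exact (extChartAt I p).map_target (hR hx)

/-- `mcutoffSupport` is compact (a continuous image of a closed ball). [folklore] -/
theorem isCompact_mcutoffSupport [FiniteDimensional ℝ E] (p : N) (T : E ≃L[ℝ] E) {r : ℝ}
    (hR : closedBall (extChartAt I p p) (2 * r * ‖(T.symm : E →L[ℝ] E)‖) ⊆
      (extChartAt I p).target) :
    IsCompact (mcutoffSupport I p T r) :=
  (isCompact_closedBall _ _).image_of_continuousOn ((continuousOn_extChartAt_symm p).mono hR)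

/-- Off `mcutoffSupport`, the cutoff equals `1`. [folklore] -/
theorem mcutoff_eq_one (p : N) (T : E ≃L[ℝ] E) {r : ℝ} (hr : 0 < r) {y : N}
    (hy : y ∉ mcutoffSupport I p T r) : mcutoff I p (T : E →L[ℝ] E) r y = 1 := by
  by_cases hys : y ∈ (extChartAt I p).source
  · rw [mcutoff_of_mem hys]
    by_contra h
    exact hy ⟨extChartAt I p y, mem_closedBall_of_cutoff_ne_one T hr h,
      (extChartAt I p).left_inv hys⟩
  · exact mcutoff_of_not_mem hys

/-- Off `mcutoffSupport`, the cutoff is eventually `1`. [folklore] -/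
theorem mcutoff_eventuallyEq_one [FiniteDimensional ℝ E] [T2Space N] (p : N) (T : E ≃L[ℝ] E)
    {r : ℝ} (hr : 0 < r)
    (hR : closedBall (extChartAt I p p) (2 * r * ‖(T.symm : E →L[ℝ] E)‖) ⊆
      (extChartAt I p).target)
    {y : N} (hy : y ∉ mcutoffSupport I p T r) :
    mcutoff I p (T : E →L[ℝ] E) r =ᶠ[𝓝 y] fun _ ↦ 1 := by
  filter_upwards [(isCompact_mcutoffSupport p T hR).isClosed.isOpen_compl.mem_nhds hy] with z hz
  exact mcutoff_eq_one p T hr hz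

/-- On the chart domain, the cutoff is the Euclidean cutoff composed with the chart.
[folklore] -/
theorem mcutoff_eventuallyEq_comp (p : N) (T : E →L[ℝ] E) (r : ℝ) {y : N}
    (hy : y ∈ (extChartAt I p).source) :
    mcutoff I p T r =ᶠ[𝓝 y] (cutoff T (extChartAt I p p) r ∘ extChartAt I p) := by
  filter_upwards [(isOpen_extChartAt_source (I := I) p).mem_nhds hy] with z hz
  exact mcutoff_of_mem hz

/-- The cutoff vanishes near `p`. [folklore] -/
theorem mcutoff_eventuallyEq_zero (p : N) (T : E →L[ℝ] E) (r : ℝ) :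
    mcutoff I p T r =ᶠ[𝓝 p] fun _ ↦ 0 := by
  have h1 := mcutoff_eventuallyEq_comp (I := I) p T r (mem_extChartAt_source (I := I) p)
  have h2 : (cutoff T (extChartAt I p p) r ∘ extChartAt I p) =ᶠ[𝓝 p] fun _ ↦ 0 :=
    (continuousAt_extChartAt (I := I) p).eventually (cutoff_eventuallyEq_zero T _ r)
  exact h1.trans h2

variable [IsManifold I ∞ N]

/-- **Smoothness of the transported cutoff** (for `r` small). [folklore] -/
theorem contMDiff_mcutoff [FiniteDimensional ℝ E] [T2Space N] (p : N) (T : E ≃L[ℝ] E) {r : ℝ}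
    (hr : 0 < r)
    (hR : closedBall (extChartAt I p p) (2 * r * ‖(T.symm : E →L[ℝ] E)‖) ⊆
      (extChartAt I p).target) :
    CMDiff ∞ (mcutoff I p (T : E →L[ℝ] E) r) := by
  intro y
  by_cases hys : y ∈ (extChartAt I p).source
  · have h1 : CMDiffAt ∞ (cutoff (T : E →L[ℝ] E) (extChartAt I p p) r ∘ extChartAt I p) y :=
      (contDiff_cutoff _ _ _).contMDiff.contMDiffAt.comp y
        (contMDiffAt_extChartAt' (by rwa [← extChartAt_source I]))
    exact h1.congr_of_eventuallyEq (mcutoff_eventuallyEq_comp p _ r hys)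
  · have hy : y ∉ mcutoffSupport I p T r := fun h ↦ hys (mcutoffSupport_subset_source p T hR h)
    exact contMDiffAt_const.congr_of_eventuallyEq (mcutoff_eventuallyEq_one p T hr hR hy)

omit [IsManifold I ∞ N] in
/-- `mvfderiv` of a function on a vector space is `fderiv`. [folklore] -/
theorem mvfderiv_eq_fderiv_apply {F : Type*} [NormedAddCommGroup F] [NormedSpace ℝ F]
    (f : E → F) (x v : E) : mvfderiv 𝓘(ℝ, E) f x v = fderiv ℝ f x v := by
  simp only [mvfderiv, ContinuousLinearMap.comp_apply, mfderiv_eq_fderiv]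
  rfl

/-- **Chain rule for the transported cutoff**: on the chart domain,
`dχ_r(y)(v) = Dχ̂(φ y)(Dφ_y v)`. [folklore] -/
theorem mvfderiv_mcutoff_apply (p : N) (T : E →L[ℝ] E) (r : ℝ) {y : N}
    (hy : y ∈ (extChartAt I p).source) (v : TangentSpace I y) :
    mvfderiv I (mcutoff I p T r) y v =
      fderiv ℝ (cutoff T (extChartAt I p p) r) (extChartAt I p y)
        (mfderiv I 𝓘(ℝ, E) (extChartAt I p) y v) := by
  have hy' : y ∈ (chartAt H p).source := by rwa [← extChartAt_source I]
  have h1 : mvfderiv I (mcutoff I p T r) y =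
      mvfderiv I (cutoff T (extChartAt I p p) r ∘ extChartAt I p) y := by
    simp only [mvfderiv]
    rw [(mcutoff_eventuallyEq_comp p T r hy).mfderiv_eq]
    congr 1
  rw [h1]
  have hd : MDiffAt (cutoff T (extChartAt I p p) r) (extChartAt I p y) :=
    ((differentiable_cutoff T (extChartAt I p p) r).differentiableAt).mdifferentiableAt
  simp only [mvfderiv, ContinuousLinearMap.comp_apply]
  rw [mfderiv_comp y hd (mdifferentiableAt_extChartAt hy')]
  show mfderiv 𝓘(ℝ, E) 𝓘(ℝ, ℝ) (cutoff T (extChartAt I p p) r) (extChartAt I p y)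
    (mfderiv I 𝓘(ℝ, E) (extChartAt I p) y v) = _
  rw [mfderiv_eq_fderiv]
  rfl

omit [IsManifold I ∞ N] in
/-- Off `mcutoffSupport`, the derivative of the cutoff vanishes. [folklore] -/
theorem mvfderiv_mcutoff_eq_zero [FiniteDimensional ℝ E] [T2Space N] (p : N) (T : E ≃L[ℝ] E)
    {r : ℝ} (hr : 0 < r)
    (hR : closedBall (extChartAt I p p) (2 * r * ‖(T.symm : E →L[ℝ] E)‖) ⊆
      (extChartAt I p).target)
    {y : N} (hy : y ∉ mcutoffSupport I p T r) :
    mvfderiv I (mcutoff I p (T : E →L[ℝ] E) r) y = 0 := by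
  have h : mfderiv I 𝓘(ℝ, ℝ) (mcutoff I p (T : E →L[ℝ] E) r) y = 0 := by
    rw [(mcutoff_eventuallyEq_one p T hr hR hy).mfderiv_eq]
    exact mfderiv_const
  simp only [mvfderiv, h, ContinuousLinearMap.comp_zero]

omit [IsManifold I ∞ N] in
/-- The derivative of the cutoff vanishes near `p`. [folklore] -/
theorem mvfderiv_mcutoff_eventuallyEq_zero (p : N) (T : E →L[ℝ] E) (r : ℝ) :
    ∀ᶠ y in 𝓝 p, mvfderiv I (mcutoff I p T r) y = 0 := by
  filter_upwards [(mcutoff_eventuallyEq_zero (I := I) p T r).eventually_nhds] with y hy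
  have hy' : mcutoff I p T r =ᶠ[𝓝 y] fun _ ↦ (0 : ℝ) := hy
  have h : mfderiv I 𝓘(ℝ, ℝ) (mcutoff I p T r) y = 0 := by
    rw [hy'.mfderiv_eq]
    exact mfderiv_const
  simp only [mvfderiv, h, ContinuousLinearMap.comp_zero]

end Cutoff

end Literature.Geometry.Riemannian

end
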